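import Summits.BirchSwinnertonDyer.BirchSwinnertonDyer.Theorems.PrintCf2SplitBadTwoLocalControlKernelGood
import Summits.BirchSwinnertonDyer.BirchSwinnertonDyer.Theorems.PrintCf2SplitBadTwoRestrictedSelmerCMSideConditions
import Summits.BirchSwinnertonDyer.BirchSwinnertonDyer.Theorems.PrintCf2SplitBadTwoCMPrimaryLocalFixedPoints
import Literature.NumberTheory.EllipticCurves.IwasawaSelmerControlLocalInputsProofs
import Literature.NumberTheory.EllipticCurves.GeomPointsGaloisModule
import HarnessLib

/-!
# Crux `PrintCf2.SplitBadTwoRankOneOfFacts` (stmt-BirchSwinnertonDyer-20368), road α v9.1 — brick B16 file 5: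
# the local kernel of control at ANY finite place is bounded by the LOCAL FIXED POINTS `#M^{D_w}`; at `v̄` it has `≤ 4` elements

Cell `bsd-print-cf2`, width seat `bsd-line-cf2-p1-w3` g7 (prover-bsd-line-cf2-p1-w3-g7-0); brick B16 (LEAD g11 18:21:06Z), fifth file —
the place `𝔮 = v̄` itself (the STRICT place, «B15, dyadic» in the LEAD's list), where the line `K*_∞/K` IS ramified and files 2–3 do
not apply. `--supports stmt-BirchSwinnertonDyer-20368` (helper, Theses-free). HONEST FRAMING: nothing here closes the crux or a registered
stub; BSD is not proved by any of this; no summit statement is proved by this seat. No definition, no named fact, no `sorry`.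

WHAT (generic: `K` a number field, `κ` a `ℤ_p`-extension, `M` a discrete `p`-primary `Γ_K`-module with OPEN stabilisers, continuous
orbit maps and FINITE levels `M[pⁿ]`, `w` ANY finite place; `H_0 = κ.layerSubgroup 0`, `H_∞ = ker κ`, `D_w = GreenbergSelmer.decomp w`):
* §1 `exists_generator_decomp_kerSubgroup` — the local layer quotient `(H_0 ⊓ D_w)/(H_∞ ⊓ D_w) ≅ κ(D_w) ≤ ℤ_p` is topologically CYCLIC:
  some `γ_w ∈ H_0 ⊓ D_w` generates `↥(H_0 ⊓ D_w)` topologically together with `H_∞ ⊓ D_w` (the tree's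
  `ZpExtension.exists_mem_localSubgroup_generate` — minimal valuation + density of `ℕ` in `ℤ_p` — pulled back along `Γ_{K_w} ↠ D_w`);
  `normal_kerSubgroup_inf_decomp_subgroupOf`; `ker_resOfLe_le_subgroupResKer_kerSubgroup` (the local kernel IS the generic restriction
  kernel of `(H_∞ ⊓ D_w).subgroupOf (H_0 ⊓ D_w)`).
* §2 **`finite_localControlKer_and_card_le_fixedPoints_decomp`** — **`#LK_w ≤ #M^{D_w}`**, `LK_w = ker (H¹(H_0 ⊓ D_w, M) → H¹(H_∞ ⊓ D_w, M))`,
  whenever `M^{D_w}` is finite: inflation–restriction `LK_w ↪ A/(γ_w − 1)A`, `A = M^{H_∞ ⊓ D_w}` (`ResKernel.finite_subgroupResKer`), and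
  PIGEONHOLE over the finite levels (`ResKernel.finite_quotient_range_of_finite_ker`): `#A/(γ_w − 1)A ≤ #ker(γ_w − 1 | A) ≤ #M^{D_w}` —
  an element of `A` fixed by `γ_w` has an open stabiliser containing `H_∞ ⊓ D_w` and `γ_w`, hence all of `D_w`. Greenberg's
  "`#ker(r_v) ≤ #E(F_v)[p^∞]`"-type bound (LNM 1716 Lemma 3.3 eq. (4)) for an arbitrary summand, in -w7's currency, ALSO at ramified `w`.
* §3 ROAD α (`M = W* = ↥((W.baseChange K).endEigenPrimaryTorsion 2 π r)`, `K ∋ √−7` quadratic, `v ≠ v̄` over `2`): `#W*^{D_v} , #W*^{D_v̄} ≤ 4`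
  (-w2 p656168 `natCard_eq_two_or_four_of_fixed`: `H⁰(K_v, W*) ∈ {ℤ/2, ℤ/4}` for EITHER local type), hence
  **`natCard_localControlKer_le_four_of_two_mem`** — at BOTH places above `2`, for EVERY `ℤ₂`-line `κ` of `K` (ramified or not), the
  local kernel of control for `W*` has `≤ 4` elements; `natCard_localControlKer_vbar_of_frame_le_four` (S3c₂ frame, the strict place `v̄`,
  no `θ`-binder): `v₂ #LK_{v̄} ≤ 2`. With files 2–4: on every S3c₂ frame the cokernel of Agboola's control map satisfies
  `v₂ [𝔖^Γ : res 𝔖] ≤ #{places of K above 7d} + 2` once `T = {v̄} ∪ {w ∣ 7d}` is admissible (class facts: `W_K` additive at `w ∣ d`, good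
  off `14d`).
presearch: Greenberg LNM 1716 §3 Lemma 3.3 eq. (4) and p. 87 ("topologically generated by `γ_{v_n}`"), Agboola 2007 Prop. 3.2 — held; tree:
`localTowerKer` currency (`finite_localTowerKerPrimary_and_card_le`); here the `Γ_K`-subgroup currency of -w7's skeleton. beyond-print theorem: no.

References: [GreenbergLNM1716] §3 Lemmas 3.1, 3.3 (pp. 86–88); [Agboola2007] §3 Prop. 3.2, §6; [Rubin1999] §2, §3 Lemma 3.6;
[NeukirchSchmidtWingberg2008] I §5–6.
-/

noncomputable section

open scoped Classical

set_option linter.dupNamespace false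
set_option autoImplicit false

open NumberField IsDedekindDomain Field WeierstrassCurve
open Literature.NumberTheory.EllipticCurves Literature.NumberTheory.EllipticCurves.GreenbergSelmer
open Literature.NumberTheory.EllipticCurves.Agboola2007
open Literature.NumberTheory.EllipticCurves.IwasawaDual
open Literature.NumberTheory.EllipticCurves.ResKernel
open Literature.NumberTheory.GaloisRepresentations
open IsDedekindDomain.HeightOneSpectrum

universe u

namespace Summit.BirchSwinnertonDyer.BirchSwinnertonDyer.Theorems.PrintCf2.RestrictedSelmerPair

/-! ## §1. `(H_0 ⊓ D_w)/(H_∞ ⊓ D_w)` is topologically cyclic -/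

section Generation

variable {K : Type u} [Field K] [NumberField K] {p : ℕ} [Fact p.Prime] (κ : ZpExtension K p)
  (w : HeightOneSpectrum (𝓞 K))

/-- **The local layer quotient is topologically cyclic.** There is `γ_w ∈ H_0 ⊓ D_w` such that every open subgroup of
`↥(H_0 ⊓ D_w)` containing `H_∞ ⊓ D_w` and `γ_w` is everything: pull back along the surjection `Γ_{K_w} ↠ D_w = H_0 ⊓ D_w` and use the
tree's `ZpExtension.exists_mem_localSubgroup_generate` (the local character `κ ∘ (Γ_{K_w} → Γ_K)` has image `0` or `p^m ℤ_p`, generated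
topologically by an element of minimal valuation). [cite: GreenbergLNM1716, §3 Lemma 3.3 (proof, p. 87)] -/
theorem exists_generator_decomp_kerSubgroup :
    ∃ γw : ↥(κ.layerSubgroup 0 ⊓ decomp w),
      ∀ U : Subgroup ↥(κ.layerSubgroup 0 ⊓ decomp w), IsOpen (U : Set ↥(κ.layerSubgroup 0 ⊓ decomp w)) →
        (κ.kerSubgroup ⊓ decomp w).subgroupOf (κ.layerSubgroup 0 ⊓ decomp w) ≤ U → γw ∈ U → U = ⊤ := by
  set G₀ := κ.layerSubgroup 0 ⊓ decomp w with hG₀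
  have hDG₀ : decomp w ≤ G₀ := fun g hg ↦ ⟨by rw [ZpExtension.layerSubgroup_zero]; trivial, hg⟩
  obtain ⟨g, -, hgen⟩ := ZpExtension.exists_mem_localSubgroup_generate κ (w.adicCompletion K) 0
  let f : absoluteGaloisGroup (w.adicCompletion K) →* ↥G₀ :=
    (absGaloisRestrict K (w.adicCompletion K)).toMonoidHom.codRestrict G₀ (fun σ ↦ hDG₀ ⟨σ, rfl⟩)
  have hfc : Continuous f := (absGaloisRestrict K (w.adicCompletion K)).continuous.subtype_mk _
  refine ⟨f g, fun U hU hNU hgU ↦ ?_⟩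
  have hU' : IsOpen ((U.comap f : Subgroup (absoluteGaloisGroup (w.adicCompletion K))) :
      Set (absoluteGaloisGroup (w.adicCompletion K))) := hU.preimage hfc
  have hN' : localSubgroup κ.kerSubgroup (w.adicCompletion K) ≤ U.comap f := by
    intro τ hτ
    rw [mem_localSubgroup_iff, resGal_eq_absGaloisRestrict] at hτ
    refine Subgroup.mem_comap.mpr (hNU ?_)
    rw [Subgroup.mem_subgroupOf]
    exact ⟨hτ, ⟨τ, rfl⟩⟩
  have htop := hgen (U.comap f) hU' hN' (Subgroup.mem_comap.mpr hgU)
  rw [eq_top_iff]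
  rintro ⟨x, hx⟩ -
  obtain ⟨σ, hσ⟩ := (mem_decomp_iff w x).mp hx.2
  have hσn : σ ∈ localSubgroup (κ.layerSubgroup 0) (w.adicCompletion K) := by
    rw [mem_localSubgroup_iff, ZpExtension.layerSubgroup_zero]; trivial
  have hσU : σ ∈ U.comap f := htop hσn
  have hfσ : f σ = ⟨x, hx⟩ := Subtype.ext hσ
  exact hfσ ▸ Subgroup.mem_comap.mp hσU

/-- `H_∞ ⊓ D_w ⊴ H_0 ⊓ D_w` (`ker κ` is normal). [folklore] -/
theorem normal_kerSubgroup_inf_decomp_subgroupOf :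
    ((κ.kerSubgroup ⊓ decomp w).subgroupOf (κ.layerSubgroup 0 ⊓ decomp w)).Normal := by
  refine ⟨fun n hn g ↦ ?_⟩
  rw [Subgroup.mem_subgroupOf] at hn ⊢
  obtain ⟨hn1, hn2⟩ := Subgroup.mem_inf.mp hn
  rw [Subgroup.coe_mul, Subgroup.coe_mul, Subgroup.coe_inv]
  refine Subgroup.mem_inf.mpr ⟨?_, ?_⟩
  · rw [ZpExtension.mem_kerSubgroup, map_mul, map_mul, map_inv, ZpExtension.mem_kerSubgroup.mp hn1, mul_one,
      mul_inv_cancel]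
  · exact (decomp w).mul_mem ((decomp w).mul_mem g.2.2 hn2) ((decomp w).inv_mem g.2.2)

variable (M : Type u) [AddCommGroup M] [DistribMulAction (absoluteGaloisGroup K) M]
  [TopologicalSpace M] [DiscreteTopology M]

/-- **The local kernel of control IS the restriction kernel of `(H_∞ ⊓ D_w).subgroupOf (H_0 ⊓ D_w)`** (up to the tautological
identification; here the inclusion that is needed). [cite: NeukirchSchmidtWingberg2008, I.§5] -/
theorem ker_resOfLe_le_subgroupResKer_kerSubgroup :
    (resOfLe M (inf_le_inf_right (decomp w) (κ.kerSubgroup_le_layerSubgroup 0) :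
        κ.kerSubgroup ⊓ decomp w ≤ κ.layerSubgroup 0 ⊓ decomp w)).ker ≤
      subgroupResKer M ((κ.kerSubgroup ⊓ decomp w).subgroupOf (κ.layerSubgroup 0 ⊓ decomp w)) := by
  intro c hc
  let j : ↥((κ.kerSubgroup ⊓ decomp w).subgroupOf (κ.layerSubgroup 0 ⊓ decomp w)) →ₜ* ↥(κ.kerSubgroup ⊓ decomp w) :=
    { toFun := fun x ↦ ⟨((x : ↥(κ.layerSubgroup 0 ⊓ decomp w)) : absoluteGaloisGroup K), Subgroup.mem_subgroupOf.mp x.2⟩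
      map_one' := rfl
      map_mul' := fun _ _ ↦ rfl
      continuous_toFun := (continuous_subtype_val.comp continuous_subtype_val).subtype_mk _ }
  have hcomp : (resH1Hom j (AddMonoidHom.id M) (fun _ _ ↦ rfl)).comp
      (resOfLe M (inf_le_inf_right (decomp w) (κ.kerSubgroup_le_layerSubgroup 0) :
        κ.kerSubgroup ⊓ decomp w ≤ κ.layerSubgroup 0 ⊓ decomp w)) =
      resSubgroup ((κ.kerSubgroup ⊓ decomp w).subgroupOf (κ.layerSubgroup 0 ⊓ decomp w)) M := by
    unfold Literature.NumberTheory.EllipticCurves.resOfLe ResKernel.resSubgroup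
    rw [resH1Hom_comp]
    exact resH1Hom_congr (ContinuousMonoidHom.ext fun _ ↦ rfl) (AddMonoidHom.ext fun _ ↦ rfl) _ _
  rw [mem_subgroupResKer_iff, ← hcomp, AddMonoidHom.comp_apply, (AddMonoidHom.mem_ker).mp hc, map_zero]

end Generation

/-! ## §2. `#LK_w ≤ #M^{D_w}` at every finite place -/

section Generic

variable {K : Type u} [Field K] [NumberField K] {p : ℕ} [Fact p.Prime] (κ : ZpExtension K p)
  (M : Type u) [AddCommGroup M] [DistribMulAction (absoluteGaloisGroup K) M]
  [TopologicalSpace M] [DiscreteTopology M] (w : HeightOneSpectrum (𝓞 K))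

/-- **THE LOCAL KERNEL OF CONTROL IS BOUNDED BY THE LOCAL FIXED POINTS: `#LK_w ≤ #M^{D_w}`.** `K` a number field, `κ` a
`ℤ_p`-extension, `w` ANY finite place (possibly ramified in the line), `M` a discrete `p`-primary `Γ_K`-module with open stabilisers,
continuous orbit maps and finite levels `M[pⁿ]`, `M^{D_w}` finite. Then `LK_w = ker (H¹(H_0 ⊓ D_w, M) → H¹(H_∞ ⊓ D_w, M))` is finite with
`#LK_w ≤ #M^{D_w}`: `LK_w ↪ A/(γ_w − 1)A` (`A = M^{H_∞ ⊓ D_w}`, `γ_w` of §1, `ResKernel.finite_subgroupResKer`) and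
`#A/(γ_w − 1)A ≤ #ker(γ_w − 1|A) ≤ #M^{D_w}` (pigeonhole over the levels; a `γ_w`-fixed element of `A` has open stabiliser `⊇ ⟨H_∞ ⊓ D_w, γ_w⟩`,
hence is `D_w`-fixed). [cite: GreenbergLNM1716, §3 Lemma 3.3 (proof, pp. 86–87)] [cite: Agboola2007, §3 Prop. 3.2] -/
theorem finite_localControlKer_and_card_le_fixedPoints_decomp
    (hcont : ∀ m : M, Continuous fun g : absoluteGaloisGroup K ↦ g • m)
    (hstab : ∀ m : M, IsOpen (MulAction.stabilizer (absoluteGaloisGroup K) m : Set (absoluteGaloisGroup K)))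
    (hprim : ∀ m : M, ∃ k : ℕ, p ^ k • m = 0)
    (hlev : ∀ n : ℕ, Finite (AddSubgroup.torsionBy M (p ^ n : ℕ)))
    [hD : Finite (FixedPoints.addSubgroup (decomp w) M)] :
    Finite (resOfLe M (inf_le_inf_right (decomp w) (κ.kerSubgroup_le_layerSubgroup 0) :
        κ.kerSubgroup ⊓ decomp w ≤ κ.layerSubgroup 0 ⊓ decomp w)).ker ∧
      Nat.card (resOfLe M (inf_le_inf_right (decomp w) (κ.kerSubgroup_le_layerSubgroup 0) :
          κ.kerSubgroup ⊓ decomp w ≤ κ.layerSubgroup 0 ⊓ decomp w)).ker ≤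
        Nat.card (FixedPoints.addSubgroup (decomp w) M) := by
  let G₀ : Subgroup (absoluteGaloisGroup K) := κ.layerSubgroup 0 ⊓ decomp w
  have hDG₀ : decomp w ≤ G₀ := fun g hg ↦ ⟨by rw [ZpExtension.layerSubgroup_zero]; trivial, hg⟩
  let N : Subgroup ↥G₀ := (κ.kerSubgroup ⊓ decomp w).subgroupOf G₀
  haveI : N.Normal := normal_kerSubgroup_inf_decomp_subgroupOf κ w
  obtain ⟨γw, hgen⟩ := exists_generator_decomp_kerSubgroup κ w
  have hcont' : ∀ m : M, Continuous fun g : ↥G₀ ↦ g • m := fun m ↦ (hcont m).comp continuous_subtype_val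
  set A := FixedPoints.addSubgroup N M with hA
  set φ := subOne N M γw with hφ
  -- (i) `ker (γw − 1 | A)` embeds into `M^{D_w}`
  have hfixall : ∀ b : A, φ b = 0 → ∀ g : ↥G₀, g • (b : M) = b := by
    intro b hb
    have hγb : γw • (b : M) = b := by
      have h := congrArg (fun z : A ↦ (z : M)) hb
      simpa only [hφ, coe_subOne_apply, ZeroMemClass.coe_zero, sub_eq_zero] using h
    -- the stabiliser of `b` in `↥G₀` is open and contains `N` and `γw`
    let S : Subgroup ↥G₀ := (MulAction.stabilizer (absoluteGaloisGroup K) (b : M)).comap G₀.subtype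
    have hSo : IsOpen (S : Set ↥G₀) := (hstab (b : M)).preimage continuous_subtype_val
    have hNS : N ≤ S := fun x hx ↦ by
      change ((x : ↥G₀) : absoluteGaloisGroup K) • (b : M) = b
      exact b.2 ⟨x, hx⟩
    have hγS : γw ∈ S := hγb
    have hS := hgen S hSo hNS hγS
    intro g
    have hg : g ∈ S := hS ▸ Subgroup.mem_top g
    exact hg
  let ι : φ.ker → FixedPoints.addSubgroup (decomp w) M := fun b ↦ ⟨((b : A) : M),
    (FixedPoints.mem_addSubgroup _ _ _).mpr fun d ↦ hfixall b ((AddMonoidHom.mem_ker).mp b.2) ⟨d, hDG₀ d.2⟩⟩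
  have hι : Function.Injective ι := fun a b hab ↦ by
    have h1 := congrArg Subtype.val hab
    exact Subtype.ext (Subtype.ext h1)
  haveI hkerfin : Finite φ.ker := Finite.of_injective ι hι
  have hkercard : Nat.card φ.ker ≤ Nat.card (FixedPoints.addSubgroup (decomp w) M) :=
    Nat.card_le_card_of_injective ι hι
  -- (ii) pigeonhole over the finite levels `A[pⁿ]`
  have hmono : Monotone (fun n ↦ AddSubgroup.torsionBy A (p ^ n : ℕ)) := fun m n hmn b hb ↦ by
    rw [AddSubgroup.torsionBy.nsmul_iff] at hb ⊢
    obtain ⟨c, hc⟩ := Nat.pow_dvd_pow p hmn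
    rw [hc, Nat.mul_comm (p ^ m) c, ← smul_smul, hb, smul_zero]
  have hcover : ∀ b : A, ∃ n, b ∈ AddSubgroup.torsionBy A (p ^ n : ℕ) := fun b ↦ by
    obtain ⟨n, hn⟩ := hprim (b : M)
    refine ⟨n, ?_⟩
    rw [AddSubgroup.torsionBy.nsmul_iff]
    exact Subtype.ext (by rw [AddSubmonoidClass.coe_nsmul, ZeroMemClass.coe_zero]; exact hn)
  have hfinlev : ∀ n, Finite (AddSubgroup.torsionBy A (p ^ n : ℕ)) := fun n ↦ by
    haveI := hlev n
    refine Finite.of_injective (fun b ↦ (⟨((b : A) : M), ?_⟩ : AddSubgroup.torsionBy M (p ^ n : ℕ))) ?_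
    · have hb := AddSubgroup.torsionBy.nsmul_iff.mp b.2
      rw [AddSubgroup.torsionBy.nsmul_iff]
      have h1 := congrArg (fun z : A ↦ (z : M)) hb
      simpa only [AddSubmonoidClass.coe_nsmul, ZeroMemClass.coe_zero] using h1
    · intro a b hab
      apply Subtype.ext; apply Subtype.ext
      exact congrArg (fun z : AddSubgroup.torsionBy M (p ^ n : ℕ) ↦ (z : M)) hab
  have hstabφ : ∀ n, ∀ b ∈ AddSubgroup.torsionBy A (p ^ n : ℕ), φ b ∈ AddSubgroup.torsionBy A (p ^ n : ℕ) :=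
    fun n b hb ↦ by
      rw [AddSubgroup.torsionBy.nsmul_iff] at hb ⊢
      rw [← map_nsmul, hb, map_zero]
  obtain ⟨hqfin, hqcard⟩ := finite_quotient_range_of_finite_ker φ _ hmono hcover hfinlev hstabφ
  -- (iii) inflation–restriction
  haveI := hqfin
  obtain ⟨hfinK, hcardK⟩ := ResKernel.finite_subgroupResKer N M γw hgen hcont'
  haveI := hfinK
  have hinj := AddSubgroup.inclusion_injective (ker_resOfLe_le_subgroupResKer_kerSubgroup κ w M)
  exact ⟨Finite.of_injective _ hinj,
    (Nat.card_le_card_of_injective _ hinj).trans (hcardK.trans (hqcard.trans hkercard))⟩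

end Generic

/-! ## §3. Road α: `≤ 4` at both places above `2`, in particular at the strict place `v̄` of every S3c₂ frame -/

section CM

open Summit.BirchSwinnertonDyer.BirchSwinnertonDyer.Theorems.PrintCf2.AdditiveAtSeven
open Summit.BirchSwinnertonDyer.BirchSwinnertonDyer.Theorems.PrintCf2.CMPrimes

variable (W : WeierstrassCurve ℚ) [W.IsElliptic] {K : Type} [Field K] [NumberField K]

/-- **`#W*^{D_v} ≤ 4` at a place above `2`** (`j = −3375`, `[K:ℚ] = 2`, `θ² = −7`, `π² = π − 2`, `r² = r − 2`, `v ≠ v̄` over `2`; EITHER local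
type): the `D_v`-fixed subgroup of the named module, pushed into `E[2^∞]`, contains `W*[2]` and is fixed by `decomp v`, so -w2's
`natCard_eq_two_or_four_of_fixed` gives `2` or `4`. [cite: Rubin1999, §3 Lemma 3.6 (ii) and Cor. 3.17] [cite: Agboola2007, §6] -/
theorem finite_and_natCard_fixedPoints_decomp_le_four (hj : W.j = -3375) (hK2 : Module.finrank ℚ K = 2) {θ : K} (hθ : θ ^ 2 = -7)
    (π : (W.baseChange K).endRing) (hrel : (π : AddMonoid.End (W.baseChange K).geomPoints) * π = π - 2)
    {r : ℤ_[2]} (hr : r * r = r - 2) {v vbar : HeightOneSpectrum (𝓞 K)}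
    (hv : ((2 : ℕ) : 𝓞 K) ∈ v.asIdeal) (hvbar : ((2 : ℕ) : 𝓞 K) ∈ vbar.asIdeal) (hne : vbar ≠ v) :
    Finite (FixedPoints.addSubgroup (decomp v) ↥((W.baseChange K).endEigenPrimaryTorsion 2 π r)) ∧
      Nat.card (FixedPoints.addSubgroup (decomp v) ↥((W.baseChange K).endEigenPrimaryTorsion 2 π r)) ≤ 4 := by
  haveI : Fact (Nat.Prime 2) := ⟨Nat.prime_two⟩
  -- the image `F ≤ E[2^∞]` of the `D_v`-fixed subgroup
  let F : AddSubgroup ((W.baseChange K).geomPrimaryTorsion 2) :=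
    (FixedPoints.addSubgroup (decomp v) ↥((W.baseChange K).endEigenPrimaryTorsion 2 π r)).map
      ((W.baseChange K).endEigenPrimaryTorsion 2 π r).subtype
  have hFM : F ≤ (W.baseChange K).endEigenPrimaryTorsion 2 π r := by
    rintro _ ⟨y, -, rfl⟩
    exact y.2
  have h2 : ∀ x ∈ (W.baseChange K).endEigenPrimaryTorsion 2 π r, 2 • x = 0 → x ∈ F := fun x hx h2x ↦
    ⟨⟨x, hx⟩, (FixedPoints.mem_addSubgroup _ _ _).mpr fun d ↦ Subtype.ext (by
      rw [Subgroup.smul_def, endEigenPrimaryTorsion.coe_smul]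
      exact smul_eq_self_of_two_nsmul_eq_zero W hj hθ π hrel hr (d : absoluteGaloisGroup K) hx h2x), rfl⟩
  have hfix : ∀ δ ∈ decomp v, ∀ x ∈ F, δ • x = x := by
    rintro δ hδ _ ⟨y, hy, rfl⟩
    have h := (FixedPoints.mem_addSubgroup _ _ _).mp hy ⟨δ, hδ⟩
    rw [Subgroup.mk_smul] at h
    have h' := congrArg (fun z : ↥((W.baseChange K).endEigenPrimaryTorsion 2 π r) ↦
      (z : (W.baseChange K).geomPrimaryTorsion 2)) h
    show δ • ((y : ↥((W.baseChange K).endEigenPrimaryTorsion 2 π r)) : (W.baseChange K).geomPrimaryTorsion 2) = y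
    simpa only [endEigenPrimaryTorsion.coe_smul] using h'
  have hcard := natCard_eq_two_or_four_of_fixed W K hj hK2 hθ π hrel hr hv hvbar hne F hFM h2 hfix
  have hcardF : Nat.card F =
      Nat.card (FixedPoints.addSubgroup (decomp v) ↥((W.baseChange K).endEigenPrimaryTorsion 2 π r)) :=
    AddSubgroup.card_map_of_injective
      (AddSubgroupClass.subtype_injective ((W.baseChange K).endEigenPrimaryTorsion 2 π r))
  have hle : Nat.card (FixedPoints.addSubgroup (decomp v) ↥((W.baseChange K).endEigenPrimaryTorsion 2 π r)) ≤ 4 := by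
    rw [← hcardF]; rcases hcard with h | h <;> omega
  have hpos : Nat.card (FixedPoints.addSubgroup (decomp v) ↥((W.baseChange K).endEigenPrimaryTorsion 2 π r)) ≠ 0 := by
    rw [← hcardF]; rcases hcard with h | h <;> omega
  exact ⟨Nat.finite_of_card_ne_zero hpos, hle⟩

/-- **`#LK_v ≤ 4` AT BOTH PLACES ABOVE `2`, FOR EVERY `ℤ₂`-LINE.** `W/ℚ` with `j = −3375`, `K` quadratic with `θ² = −7`, `v ≠ v̄` over `2`,
`π ∈ End_K(E_K)`, `π² = π − 2`, `r² = r − 2`, `κ` ANY `ℤ₂`-extension of `K` (ramified at `v` or not): the local kernel of control for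
`W* = ↥((W.baseChange K).endEigenPrimaryTorsion 2 π r)` at `v` is finite with `# ≤ #W*^{D_v} ≤ 4` (§2; open stabilisers, continuous orbits and
finite levels from -w7's `…CMSideConditions` / the tree). [cite: GreenbergLNM1716, §3 Lemma 3.3] [cite: Agboola2007, §3 Prop. 3.2, §6] -/
theorem natCard_localControlKer_le_four_of_two_mem (hj : W.j = -3375) (hK2 : Module.finrank ℚ K = 2) {θ : K}
    (hθ : θ ^ 2 = -7) (π : (W.baseChange K).endRing) (hrel : (π : AddMonoid.End (W.baseChange K).geomPoints) * π = π - 2)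
    {r : ℤ_[2]} (hr : r * r = r - 2) (κ : ZpExtension K 2) {v vbar : HeightOneSpectrum (𝓞 K)}
    (hv : ((2 : ℕ) : 𝓞 K) ∈ v.asIdeal) (hvbar : ((2 : ℕ) : 𝓞 K) ∈ vbar.asIdeal) (hne : vbar ≠ v) :
    Finite (resOfLe ↥((W.baseChange K).endEigenPrimaryTorsion 2 π r)
        (inf_le_inf_right (decomp v) (κ.kerSubgroup_le_layerSubgroup 0) :
          κ.kerSubgroup ⊓ decomp v ≤ κ.layerSubgroup 0 ⊓ decomp v)).ker ∧
      Nat.card (resOfLe ↥((W.baseChange K).endEigenPrimaryTorsion 2 π r)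
        (inf_le_inf_right (decomp v) (κ.kerSubgroup_le_layerSubgroup 0) :
          κ.kerSubgroup ⊓ decomp v ≤ κ.layerSubgroup 0 ⊓ decomp v)).ker ≤ 4 := by
  haveI : (W.baseChange K).IsElliptic := by rw [baseChange]; infer_instance
  obtain ⟨hfinD, hleD⟩ := finite_and_natCard_fixedPoints_decomp_le_four W hj hK2 hθ π hrel hr hv hvbar hne
  haveI := hfinD
  -- finite levels: `W*[2ⁿ] ↪ E[2^∞][2ⁿ]`
  have hlev : ∀ n : ℕ, Finite (AddSubgroup.torsionBy ↥((W.baseChange K).endEigenPrimaryTorsion 2 π r) (2 ^ n : ℕ)) := by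
    intro n
    haveI := (W.baseChange K).finite_torsionBy_geomPrimaryTorsion 2 n
    refine Finite.of_injective (fun b ↦ (⟨((b : ↥((W.baseChange K).endEigenPrimaryTorsion 2 π r)) :
        (W.baseChange K).geomPrimaryTorsion 2), ?_⟩ :
        AddSubgroup.torsionBy ((W.baseChange K).geomPrimaryTorsion 2) (2 ^ n : ℕ))) ?_
    · have hb := AddSubgroup.torsionBy.nsmul_iff.mp b.2
      rw [AddSubgroup.torsionBy.nsmul_iff]
      have h1 := congrArg (fun z : ↥((W.baseChange K).endEigenPrimaryTorsion 2 π r) ↦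
        (z : (W.baseChange K).geomPrimaryTorsion 2)) hb
      simpa only [AddSubmonoidClass.coe_nsmul, ZeroMemClass.coe_zero] using h1
    · intro a b hab
      apply Subtype.ext; apply Subtype.ext
      exact congrArg (fun z : AddSubgroup.torsionBy ((W.baseChange K).geomPrimaryTorsion 2) (2 ^ n : ℕ) ↦
        (z : (W.baseChange K).geomPrimaryTorsion 2)) hab
  obtain ⟨hfin, hle⟩ := finite_localControlKer_and_card_le_fixedPoints_decomp κ
    ↥((W.baseChange K).endEigenPrimaryTorsion 2 π r) v
    (continuous_smul_endEigenPrimaryTorsion (W.baseChange K) 2 π r)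
    (isOpen_stabilizer_endEigenPrimaryTorsion (W.baseChange K) 2 π r)
    (exists_pow_smul_endEigenPrimaryTorsion_eq_zero (W.baseChange K) 2 π r) hlev
  exact ⟨hfin, hle.trans hleD⟩

/-- **ROAD α, THE STRICT PLACE `v̄`: `#LK_{v̄} ≤ 4`, `v₂ ≤ 2`, on every S3c₂ frame** (member `C • W = cm7^{(d)}`, `K` imaginary quadratic,
`v ≠ v̄` over `2`, `π ∈ End_K(E_K)` with `π² = π − 2`, `r² = r − 2`, ANY `ℤ₂`-line `κ'`; no `θ`-binder). The dyadic local kernel of the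
LEAD's list («B15»), bounded class-uniformly. [cite: Agboola2007, §3 Prop. 3.2, §6] [cite: GreenbergLNM1716, §3 Lemma 3.3] -/
theorem natCard_localControlKer_vbar_of_frame_le_four {d : ℤ} (hd0 : d ≠ 0) (W : WeierstrassCurve ℚ) [W.IsElliptic]
    (C : VariableChange ℚ) (hC : C • W = cm7.quadraticTwist (d : ℚ)) (hK : IsImaginaryQuadratic K)
    {v vbar : HeightOneSpectrum (𝓞 K)} (hv : ((2 : ℕ) : 𝓞 K) ∈ v.asIdeal) (hvbar : ((2 : ℕ) : 𝓞 K) ∈ vbar.asIdeal)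
    (hne : vbar ≠ v) (π : (W.baseChange K).endRing)
    (hrel : (π : AddMonoid.End (W.baseChange K).geomPoints) * π = π - 2) {r : ℤ_[2]} (hr : r * r = r - 2)
    (κ' : ZpExtension K 2) :
    Finite (resOfLe ↥((W.baseChange K).endEigenPrimaryTorsion 2 π r)
        (inf_le_inf_right (decomp vbar) (κ'.kerSubgroup_le_layerSubgroup 0) :
          κ'.kerSubgroup ⊓ decomp vbar ≤ κ'.layerSubgroup 0 ⊓ decomp vbar)).ker ∧
      Nat.card (resOfLe ↥((W.baseChange K).endEigenPrimaryTorsion 2 π r)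
        (inf_le_inf_right (decomp vbar) (κ'.kerSubgroup_le_layerSubgroup 0) :
          κ'.kerSubgroup ⊓ decomp vbar ≤ κ'.layerSubgroup 0 ⊓ decomp vbar)).ker ≤ 4 := by
  have hj : W.j = -3375 := j_eq_of_smul_eq_cm7Twist hd0 W C hC
  obtain ⟨θ, hθ⟩ := exists_sq_eq_neg_seven_of_cmEndo_mem_endRing W K hj π hrel
  exact natCard_localControlKer_le_four_of_two_mem W hj hK.1 hθ π hrel hr κ' hvbar hv hne.symm

end CM

end Summit.BirchSwinnertonDyer.BirchSwinnertonDyer.Theorems.PrintCf2.RestrictedSelmerPair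

end
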